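import Summits.Ventures.PercRepro.PurePairGraphDefs
import Summits.Ventures.PercRepro.GZSwapB

/-!
# The pure-pair gadget — vertices, open paths and the candidate clusters (graph half, module 2a)

Lemma (B′): for `purePairGadget p q r s n`, a configuration is `bot` iff it is `Local`; under
`Local` the open cluster of a mark `m` is `K ω m`, and the cluster of the centre, when it attaches
to no mark, is `XR ω` — by the closed-cut lemma `mem_of_conn_of_closed_boundary` over the eight
kinds of edges (`c – x`; the hubs' `x`- and mark edges; the pair's `u–v`, `x–u`, `x–v`, `c–u`,
`c–v`).
-/

namespace PercRepro.PurePairGraph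

open MultiGraph StarGadgetGraph

variable {p q r s n : ℕ}

/-! ### Vertices -/

/-- `vm` is injective. -/
theorem vm_inj {m m' : Fin 3} : (vm m : PV p q r s n) = vm m' ↔ m = m' := by
  simp [vm, Fin.castSucc_inj]

/-- A mark is not the centre. -/
theorem vm_ne_vx (m : Fin 3) : (vm m : PV p q r s n) ≠ vx := by
  simp only [vm, vx, ne_eq, Sum.inl.injEq]
  fin_cases m <;> decide

/-- A mark is not a hub vertex. -/
theorem vm_ne_hv (m : Fin 3) (h : Hub p q r s) : (vm m : PV p q r s n) ≠ hv h := Sum.inl_ne_inr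

/-- A mark is not a pair vertex. -/
theorem vm_ne_pv (m : Fin 3) (j : Fin n) (w : Bool) : (vm m : PV p q r s n) ≠ pv j w :=
  Sum.inl_ne_inr

/-- The centre is not a hub vertex. -/
theorem vx_ne_hv (h : Hub p q r s) : (vx : PV p q r s n) ≠ hv h := Sum.inl_ne_inr

/-- The centre is not a pair vertex. -/
theorem vx_ne_pv (j : Fin n) (w : Bool) : (vx : PV p q r s n) ≠ pv j w := Sum.inl_ne_inr

/-- A hub vertex is not a pair vertex. -/
theorem hv_ne_pv (h : Hub p q r s) (j : Fin n) (w : Bool) : (hv h : PV p q r s n) ≠ pv j w := by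
  intro e
  have := Sigma.mk.inj_iff.1 (Sum.inr.inj e)
  cases this.1

/-- `hv` is injective. -/
theorem hv_inj {h h' : Hub p q r s} : (hv h : PV p q r s n) = hv h' ↔ h = h' := by
  constructor
  · intro e
    have := Sigma.mk.inj_iff.1 (Sum.inr.inj e)
    exact Sum.inl.inj this.1
  · rintro rfl; rfl

/-- `pv` is injective. -/
theorem pv_inj {j j' : Fin n} {w w' : Bool} : (pv j w : PV p q r s n) = pv j' w' ↔ j = j' ∧ w = w' := by
  constructor
  · intro e
    have := Sigma.mk.inj_iff.1 (Sum.inr.inj e)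
    obtain rfl := Sum.inr.inj this.1
    exact ⟨rfl, eq_of_heq this.2⟩
  · rintro ⟨rfl, rfl⟩; rfl

/-! ### The pair vocabulary on the two vertices -/

/-- `xatt` is symmetric across an open `u – v`. -/
theorem xatt_swap {s : Fin 5 → Bool} (h : puv s) (w : Bool) : xatt s w ↔ xatt s (!w) := by
  cases w <;> simp [xatt, h, or_comm]

/-- `catt` is symmetric across an open `u – v`. -/
theorem catt_swap {s : Fin 5 → Bool} (h : puv s) (w : Bool) : catt s w ↔ catt s (!w) := by
  cases w <;> simp [catt, h, or_comm]

/-- An open x-edge gives `xatt`. -/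
theorem xatt_of_pxo {s : Fin 5 → Bool} {w : Bool} (h : pxo s w) : xatt s w := Or.inl h

/-- An open c-edge gives `catt`. -/
theorem catt_of_pco {s : Fin 5 → Bool} {w : Bool} (h : pco s w) : catt s w := Or.inl h

/-- A vertex reaching both `x` and `c` inside the pair gives an `x – c` path. -/
theorem xcPath_of_xatt_catt {s : Fin 5 → Bool} {w : Bool} (hx : xatt s w) (hc : catt s w) :
    xcPath s := by
  rcases hx with hx | ⟨huv, hx⟩
  · exact ⟨w, hx, hc⟩
  · exact ⟨!w, hx, (catt_swap huv w).1 hc⟩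

/-! ### The open paths of the gadget -/

/-- An open mark edge joins the mark to its hub. -/
theorem conn_vm_hv_of_markOpen {ω : Config (PE p q r s n)} {h : Hub p q r s} {m : Fin 3}
    (hm : markOpen ω h m) : (purePairGadget p q r s n).Conn ω (vm m) (hv h) := by
  obtain ⟨i, rfl, hi⟩ := hm
  exact Conn.of_openAdj ((purePairGadget p q r s n).openAdj_of_open (.inr ⟨.inl h, some i⟩) hi)

/-- An open `x`-edge joins the centre to its hub. -/
theorem conn_vx_hv_of_xOpen {ω : Config (PE p q r s n)} {h : Hub p q r s} (hx : xOpen ω h) :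
    (purePairGadget p q r s n).Conn ω vx (hv h) :=
  Conn.of_openAdj ((purePairGadget p q r s n).openAdj_of_open (.inr ⟨.inl h, none⟩) hx)

/-- The open edge `c – x` joins `c` to the centre. -/
theorem conn_c_vx_of_cxOpen {ω : Config (PE p q r s n)} (hc : cxOpen ω) :
    (purePairGadget p q r s n).Conn ω (vm 2) vx :=
  Conn.of_openAdj ((purePairGadget p q r s n).openAdj_of_open (.inl 0) hc)

/-- An open x-edge of a pair vertex joins the centre to it. -/
theorem conn_vx_pv_of_pxo {ω : Config (PE p q r s n)} {j : Fin n} {w : Bool}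
    (hx : pxo (pairState ω j) w) : (purePairGadget p q r s n).Conn ω vx (pv j w) := by
  cases w
  · exact Conn.of_openAdj ((purePairGadget p q r s n).openAdj_of_open (.inr ⟨.inr j, (1 : Fin 5)⟩) hx)
  · exact Conn.of_openAdj ((purePairGadget p q r s n).openAdj_of_open (.inr ⟨.inr j, (2 : Fin 5)⟩) hx)

/-- An open c-edge of a pair vertex joins `c` to it. -/
theorem conn_c_pv_of_pco {ω : Config (PE p q r s n)} {j : Fin n} {w : Bool}
    (hc : pco (pairState ω j) w) : (purePairGadget p q r s n).Conn ω (vm 2) (pv j w) := by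
  cases w
  · exact Conn.of_openAdj ((purePairGadget p q r s n).openAdj_of_open (.inr ⟨.inr j, (3 : Fin 5)⟩) hc)
  · exact Conn.of_openAdj ((purePairGadget p q r s n).openAdj_of_open (.inr ⟨.inr j, (4 : Fin 5)⟩) hc)

/-- An open `u – v` joins the two vertices of a pair. -/
theorem conn_pv_pv_of_puv {ω : Config (PE p q r s n)} {j : Fin n} (h : puv (pairState ω j)) (w : Bool) :
    (purePairGadget p q r s n).Conn ω (pv j (!w)) (pv j w) := by
  have e := Conn.of_openAdj ((purePairGadget p q r s n).openAdj_of_open (.inr ⟨.inr j, (0 : Fin 5)⟩) h)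
  cases w
  · exact e.symm
  · exact e

/-- `xatt` gives an open path from the centre. -/
theorem conn_vx_pv_of_xatt {ω : Config (PE p q r s n)} {j : Fin n} {w : Bool}
    (hx : xatt (pairState ω j) w) : (purePairGadget p q r s n).Conn ω vx (pv j w) := by
  rcases hx with hx | ⟨huv, hx⟩
  · exact conn_vx_pv_of_pxo hx
  · exact (conn_vx_pv_of_pxo hx).trans (conn_pv_pv_of_puv huv w)

/-- `catt` gives an open path from `c`. -/
theorem conn_c_pv_of_catt {ω : Config (PE p q r s n)} {j : Fin n} {w : Bool}
    (hc : catt (pairState ω j) w) : (purePairGadget p q r s n).Conn ω (vm 2) (pv j w) := by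
  rcases hc with hc | ⟨huv, hc⟩
  · exact conn_c_pv_of_pco hc
  · exact (conn_c_pv_of_pco hc).trans (conn_pv_pv_of_puv huv w)

/-- A pair joining `x` to `c` connects them. -/
theorem conn_c_vx_of_xcPath {ω : Config (PE p q r s n)} {j : Fin n} (h : xcPath (pairState ω j)) :
    (purePairGadget p q r s n).Conn ω (vm 2) vx := by
  obtain ⟨w, hx, hc⟩ := h
  exact (conn_c_pv_of_catt hc).trans (conn_vx_pv_of_pxo hx).symm

/-- If `x` attaches to `m`, the mark `m` is joined to the centre. -/
theorem conn_vm_vx_of_att {ω : Config (PE p q r s n)} {m : Fin 3} (hA : Att ω m) :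
    (purePairGadget p q r s n).Conn ω (vm m) vx := by
  rcases hA with ⟨rfl, hc | ⟨j, hj⟩⟩ | ⟨h, hx, hm⟩
  · exact conn_c_vx_of_cxOpen hc
  · exact conn_c_vx_of_xcPath hj
  · exact (conn_vm_hv_of_markOpen hm).trans (conn_vx_hv_of_xOpen hx).symm

/-! ### `bot → Local` -/

/-- In a bot configuration two distinct marks are disconnected. -/
theorem not_conn_vm_of_isBot {ω : Config (PE p q r s n)}
    (hb : (purePairGadget p q r s n).IsBot ω (vm 0) (vm 1) (vm 2)) (m m' : Fin 3) (hne : m ≠ m') :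
    ¬ (purePairGadget p q r s n).Conn ω (vm m) (vm m') := by
  obtain ⟨h01, h02, h12⟩ := hb
  have h10 : ¬ (purePairGadget p q r s n).Conn ω (vm 1) (vm 0) := fun h => h01 h.symm
  have h20 : ¬ (purePairGadget p q r s n).Conn ω (vm 2) (vm 0) := fun h => h02 h.symm
  have h21 : ¬ (purePairGadget p q r s n).Conn ω (vm 2) (vm 1) := fun h => h12 h.symm
  fin_cases m <;> fin_cases m' <;> simp_all

/-- `bot → Local`: each violated clause gives an open path between two distinct marks. -/
theorem local_of_isBot {ω : Config (PE p q r s n)}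
    (hb : (purePairGadget p q r s n).IsBot ω (vm 0) (vm 1) (vm 2)) : Local ω := by
  refine ⟨fun h m m' hm hm' => ?_, fun h h' m m' hx hx' hm hm' => ?_, fun hc h m hx hm => ?_⟩
  · by_contra hne
    exact not_conn_vm_of_isBot hb m m' hne
      ((conn_vm_hv_of_markOpen hm).trans (conn_vm_hv_of_markOpen hm').symm)
  · by_contra hne
    exact not_conn_vm_of_isBot hb m m' hne
      ((conn_vm_hv_of_markOpen hm).trans ((conn_vx_hv_of_xOpen hx).symm.trans
        ((conn_vx_hv_of_xOpen hx').trans (conn_vm_hv_of_markOpen hm').symm)))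
  · by_contra hne
    have hcx : (purePairGadget p q r s n).Conn ω (vm 2) vx := by
      rcases hc with hc | ⟨j, hj⟩
      · exact conn_c_vx_of_cxOpen hc
      · exact conn_c_vx_of_xcPath hj
    exact not_conn_vm_of_isBot hb m 2 hne
      ((conn_vm_hv_of_markOpen hm).trans ((conn_vx_hv_of_xOpen hx).symm.trans hcx.symm))

/-! ### Membership in `K ω m` and `XR ω` -/

/-- Membership in `K ω m`, unfolded. -/
theorem mem_K_iff {ω : Config (PE p q r s n)} {m : Fin 3} {u : PV p q r s n} :
    u ∈ K ω m ↔ ((u = vm m ∨ ∃ h, u = hv h ∧ ¬ xOpen ω h ∧ markOpen ω h m) ∨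
      (m = 2 ∧ ∃ j w, u = pv j w ∧ catt (pairState ω j) w)) ∨
      (Att ω m ∧ (u = vx ∨ (∃ h, u = hv h ∧ xOpen ω h) ∨
        ∃ j w, u = pv j w ∧ xatt (pairState ω j) w)) := by
  simp only [K, Set.mem_union, Set.mem_singleton_iff, Set.mem_setOf_eq]

/-- The mark `m'` lies in `K ω m` iff `m' = m`. -/
theorem vm_mem_K_iff {ω : Config (PE p q r s n)} {m m' : Fin 3} :
    (vm m' : PV p q r s n) ∈ K ω m ↔ m' = m := by
  rw [mem_K_iff]
  constructor
  · rintro (((h | ⟨h, hh, -⟩) | ⟨-, j, w, hh, -⟩) | ⟨-, h | ⟨h, hh, -⟩ | ⟨j, w, hh, -⟩⟩)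
    · exact vm_inj.1 h
    · exact absurd hh (vm_ne_hv _ _)
    · exact absurd hh (vm_ne_pv _ _ _)
    · exact absurd h (vm_ne_vx _)
    · exact absurd hh (vm_ne_hv _ _)
    · exact absurd hh (vm_ne_pv _ _ _)
  · rintro rfl
    exact Or.inl (Or.inl (Or.inl rfl))

/-- The centre lies in `K ω m` iff `x` attaches to `m`. -/
theorem vx_mem_K_iff {ω : Config (PE p q r s n)} {m : Fin 3} :
    (vx : PV p q r s n) ∈ K ω m ↔ Att ω m := by
  rw [mem_K_iff]
  constructor
  · rintro (((h | ⟨h, hh, -⟩) | ⟨-, j, w, hh, -⟩) | ⟨hA, -⟩)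
    · exact absurd h.symm (vm_ne_vx _)
    · exact absurd hh (vx_ne_hv _)
    · exact absurd hh (vx_ne_pv _ _)
    · exact hA
  · intro hA
    exact Or.inr ⟨hA, Or.inl rfl⟩

/-- A hub vertex lies in `K ω m` iff it hangs from `m` with closed `x`-edge, or from the centre
when `x` attaches to `m`. -/
theorem hv_mem_K_iff {ω : Config (PE p q r s n)} {m : Fin 3} {h : Hub p q r s} :
    (hv h : PV p q r s n) ∈ K ω m ↔ (¬ xOpen ω h ∧ markOpen ω h m) ∨ (Att ω m ∧ xOpen ω h) := by
  rw [mem_K_iff]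
  constructor
  · rintro (((h1 | ⟨h', hh, hx, hm⟩) | ⟨-, j, w, hh, -⟩) | ⟨hA, h1 | ⟨h', hh, hx⟩ | ⟨j, w, hh, -⟩⟩)
    · exact absurd h1.symm (vm_ne_hv _ _)
    · obtain rfl := hv_inj.1 hh
      exact Or.inl ⟨hx, hm⟩
    · exact absurd hh (hv_ne_pv _ _ _)
    · exact absurd h1.symm (vx_ne_hv _)
    · obtain rfl := hv_inj.1 hh
      exact Or.inr ⟨hA, hx⟩
    · exact absurd hh (hv_ne_pv _ _ _)
  · rintro (⟨hx, hm⟩ | ⟨hA, hx⟩)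
    · exact Or.inl (Or.inl (Or.inr ⟨h, rfl, hx, hm⟩))
    · exact Or.inr ⟨hA, Or.inr (Or.inl ⟨h, rfl, hx⟩)⟩

/-- A pair vertex lies in `K ω m` iff (`m = c` and it reaches `c` inside its pair) or (`x` attaches
to `m` and it reaches `x` inside its pair). -/
theorem pv_mem_K_iff {ω : Config (PE p q r s n)} {m : Fin 3} {j : Fin n} {w : Bool} :
    (pv j w : PV p q r s n) ∈ K ω m ↔
      (m = 2 ∧ catt (pairState ω j) w) ∨ (Att ω m ∧ xatt (pairState ω j) w) := by
  rw [mem_K_iff]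
  constructor
  · rintro (((h1 | ⟨h', hh, -⟩) | ⟨hm, j', w', hh, hc⟩) | ⟨hA, h1 | ⟨h', hh, -⟩ | ⟨j', w', hh, hx⟩⟩)
    · exact absurd h1.symm (vm_ne_pv _ _ _)
    · exact absurd hh.symm (hv_ne_pv _ _ _)
    · obtain ⟨rfl, rfl⟩ := pv_inj.1 hh
      exact Or.inl ⟨hm, hc⟩
    · exact absurd h1.symm (vx_ne_pv _ _)
    · exact absurd hh.symm (hv_ne_pv _ _ _)
    · obtain ⟨rfl, rfl⟩ := pv_inj.1 hh
      exact Or.inr ⟨hA, hx⟩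
  · rintro (⟨hm, hc⟩ | ⟨hA, hx⟩)
    · exact Or.inl (Or.inr ⟨hm, j, w, rfl, hc⟩)
    · exact Or.inr ⟨hA, Or.inr (Or.inr ⟨j, w, rfl, hx⟩)⟩

/-- Membership in `XR ω`, unfolded. -/
theorem mem_XR_iff {ω : Config (PE p q r s n)} {u : PV p q r s n} :
    u ∈ XR ω ↔ (u = vx ∨ ∃ h, u = hv h ∧ xOpen ω h) ∨ ∃ j w, u = pv j w ∧ xatt (pairState ω j) w := by
  simp only [XR, Set.mem_union, Set.mem_singleton_iff, Set.mem_setOf_eq]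

/-- The centre lies in `XR`. -/
theorem vx_mem_XR {ω : Config (PE p q r s n)} : (vx : PV p q r s n) ∈ XR ω :=
  mem_XR_iff.2 (Or.inl (Or.inl rfl))

/-- A mark does not lie in `XR`. -/
theorem vm_not_mem_XR {ω : Config (PE p q r s n)} (m : Fin 3) : (vm m : PV p q r s n) ∉ XR ω := by
  rw [mem_XR_iff]
  rintro ((h | ⟨h, hh, -⟩) | ⟨j, w, hh, -⟩)
  · exact vm_ne_vx _ h
  · exact vm_ne_hv _ _ hh
  · exact vm_ne_pv _ _ _ hh

/-- A hub vertex lies in `XR` iff its `x`-edge is open. -/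
theorem hv_mem_XR_iff {ω : Config (PE p q r s n)} {h : Hub p q r s} :
    (hv h : PV p q r s n) ∈ XR ω ↔ xOpen ω h := by
  rw [mem_XR_iff]
  constructor
  · rintro ((h1 | ⟨h', hh, hx⟩) | ⟨j, w, hh, -⟩)
    · exact absurd h1 (vx_ne_hv _).symm
    · obtain rfl := hv_inj.1 hh
      exact hx
    · exact absurd hh (hv_ne_pv _ _ _)
  · intro hx
    exact Or.inl (Or.inr ⟨h, rfl, hx⟩)

/-- A pair vertex lies in `XR` iff it reaches `x` inside its pair. -/
theorem pv_mem_XR_iff {ω : Config (PE p q r s n)} {j : Fin n} {w : Bool} :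
    (pv j w : PV p q r s n) ∈ XR ω ↔ xatt (pairState ω j) w := by
  rw [mem_XR_iff]
  constructor
  · rintro ((h1 | ⟨h', hh, -⟩) | ⟨j', w', hh, hx⟩)
    · exact absurd h1 (vx_ne_pv _ _).symm
    · exact absurd hh.symm (hv_ne_pv _ _ _)
    · obtain ⟨rfl, rfl⟩ := pv_inj.1 hh
      exact hx
  · intro hx
    exact Or.inr ⟨j, w, rfl, hx⟩

end PercRepro.PurePairGraph
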